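import Summits.CriticalPhenomena.PercolationContinuityZ3.Theses.PercFoamCut
import Summits.CriticalPhenomena.PercolationContinuityZ3.Theorems.QuantitativeBGN.Negative.LoadBearing
import HarnessLib.Audit

/-!
# Birth skeleton (BC3) for the crux `LogBGN` (stmt-CriticalPhenomena-5334), route `PercFoamCut`

Registrar: planner-skel-stmt-CriticalPhenomena-5334-0 (skeleton-register one-shot, 2026-08-17),
file `Cruxes/LogBGN/Lines/birth.lean`.

The crux (FIXED; the route's decl `Summit.CriticalPhenomena.PercolationContinuityZ3.Theses.PercFoamCut.LogBGN`,
rank 3, "the leak rate of the foam cells"):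

  `log r · P_{p_c(ℤ³)}(arm_H(0,r)) → 0` as `r → ∞`,

`arm_H(0,r) = {∃ y, ‖y‖∞ ≥ r ∧ 0 ↔ y open inside H}`, `H = {x | 0 ≤ x 0}` — literally the event `armH r`
of the 0913 Negative lane (`Theorems/QuantitativeBGN/Negative`), readback `logBGN_iff` below by `Iff.rfl`.
Barsky–Grimmett–Newman (`θ_H(p_c) = 0`, PROVED in tree: `BarskyGrimmettNewman1991_Z3_holds`, in this
language `tendsto_armH_criticalProb`) is the rate-free statement `P(arm_H(0,r)) → 0`; the crux is the
logarithmic rate, strictly weaker than the sibling cruxes `QuantitativeBGN` (0913, power `r^{-a}`) and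
`HalfSpaceOneArmRate` (6983, power `b > 1/2`).

LINE ("superpolynomial steering"): a log rate is what a multiscale argument in the half-space gives when
the steering scale is allowed to grow POLYNOMIALLY (`r ↦ r^m`) instead of geometrically (`r ↦ m r`, which
gives a power law). Two registered stubs:

* `stub_shellSubmult` (p-blind plumbing, PROVABLE NOW, size M; verbatim the stub of the same name in
  `Cruxes/HalfSpaceOneArmRate/Lines/birth.lean`, so ONE proof serves both lines): **half-space arm
  submultiplicativity across a shell** — for every density `p` and `1 ≤ r < R`,
  `P_p(arm_H(0,R)) ≤ P_p(arm_H(0,r)) · P_p(ShellCross_H(r,R))`, where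
  `ShellCross_H(r,R) = {∃ w y, ‖w‖∞ ≤ r+1, ‖y‖∞ ≥ R, w ↔ y open inside H ∩ {‖x‖∞ > r}}`.
  Proof sketch: `P_p`-a.s. `ω ⊆ E(ℤ³)`; an open `H`-path from `0` to sup-distance `R` contains an initial
  piece up to its FIRST vertex of sup-norm `r` (an `H`-arm using only edges with both ends in `Λ_r`) and a
  final piece from the successor of its LAST `Λ_r`-vertex (sup-norm exactly `r+1`) to the endpoint, inside
  `H ∩ {‖x‖∞ ≥ r+1}` (only edges with both ends outside `Λ_r`); events measurable w.r.t. disjoint edge sets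
  are independent under the product measure (`bondPercolation` = `setBer(E(ℤ³), p)`;
  BondPercolationBlockIndependence.lean / FiniteEnergy.lean), and the inner piece implies `arm_H(0,r)`.
* `stub_powerShell` (the OPEN core, crux-class, LOAD-BEARING): **superpolynomial half-space steering at
  `p_c(ℤ³)`** — there are an integer power `m ≥ 2`, a scale `r₀ ≥ 2` and a ceiling `q` with `m · q < 1` such
  that `P_{p_c}(ShellCross_H(r, r^m)) ≤ q` for every `r ≥ r₀`: the half-ball `Λ_{r+1} ∩ H` is joined inside
  `H ∩ {‖x‖∞ > r}` to sup-distance `r^m` with probability at most `q < 1/m`, UNIFORMLY in `r`.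
  This is an EFFECTIVE form of BGN's finite-size criterion: BGN gives, for each FIXED `r`,
  `P_{p_c}(ShellCross_H(r,R)) → 0` as `R → ∞` (the decreasing limit event forces an infinite `H`-cluster at
  one of the finitely many start vertices, null by `θ_H(p_c) = 0`), i.e. SOME steering scale `R(r)` with
  `P ≤ q`; the stub says `R(r) = r^m` suffices. Scaling prediction: `P_{p_c}(ShellCross_H(r,R)) ≍ (r/R)^{x_s}`,
  `x_s = 0.975(4)` (Deng–Blöte 2005, doi:10.1103/PhysRevE.71.016117), so `P(ShellCross_H(r,r²)) ≍ r^{-0.975} → 0`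
  and the stub holds with enormous margin (any `m`, any `q > 0`, `r₀` large). Why it might fail: not by truth
  under any scaling picture — by technique: it needs a QUANTITATIVE (polynomial-scale) rerun of the BGN
  block/steering construction at `θ_H(p_c) = 0`, none in print for `d = 3` (Grimmett 1999 §7.3 is soft;
  half-space rates exist only for `d > 6`, arXiv:1810.03750, arXiv:2512.13624). The threshold `m q < 1` is
  exactly what the bookkeeping needs (with `m q = 1` one only gets `h = O(1/log r)`), not a hand-picked
  constant. It is NOT the crux (single pair of scales, set-to-sphere event, no rate in `r`, no `log`) and
  NOT the sibling stub `stub_shellDecay` of 6983 (constant ratio `m r`, defect `m^{-b}`): given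
  submultiplicativity OF SHELL CROSSINGS the constant-ratio defect implies it (chain `log_m r` shells:
  `P(ShellCross_H(r, r²)) ≤ r^{-b}`), not conversely — it allows the constant-ratio defect to decay slowly
  with the scale, which is precisely the slack between a power law and a log rate.
* `LogBGN_of (h₁ : __Registered.stub_shellSubmult) (h₂ : __Registered.stub_powerShell) : LogBGN`
  (PROVED here, no `sorry`): the bookkeeping `logRate_of_powerShell` — along the scales `r_k = r₀^{m^k}`
  (`r_{k+1} = r_k^m`) the two stubs give `P(arm_H(0,r_k)) ≤ q^k`; for `r_k ≤ r < r_{k+1}` monotonicity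
  (`armH_antitone`, 0913 Negative lane) and `log r < log r_{k+1} = m^{k+1} log r₀` give
  `0 ≤ log r · P(arm_H(0,r)) ≤ m log r₀ · (m q)^k → 0` (`m q < 1`; the window index `k` via `Nat.log`).
  So the implied rate is `h(r) = O((log r)^{-log(1/q)/log m})`, a polylog with exponent `> 1`.

Negative knowledge honoured (`Theorems/QuantitativeBGN/Negative`, same event `armH`): `armH_lower_bound`
(`P(arm_H(0,n+1)) ≥ 1/(588 (n+1)²)`) is compatible — along `r_k = r₀^{m^k}` it only asks
`q^k ≥ c · r₀^{-2 m^k}` (exponential vs doubly-exponential); `quantitativeBGN_false_without_rPos`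
(`armH 0 = univ`): the stubs carry the guards `1 ≤ r`, `2 ≤ r₀`, and the crux's `log 0 = log 1 = 0` kills
`r ≤ 1` anyway; `not_uniform_above` / `quantitativeBGNAt_false_of_theta_pos`: `stub_powerShell` is at
`p = p_c` exactly (at `p > p_c` it is false: `θ_H(p) > 0` forces `P(ShellCross_H(r,R)) ≥ θ_H(p)`), while the
p-blind `stub_shellSubmult` is true at every `p`. No `Disproof.lean` / crux ideas exist for 5334
(`ledger crux ls stmt-CriticalPhenomena-5334`: no workfiles, 2026-08-17). `ledger negatives --problem
CriticalPhenomena`: no refuted statement concerns half-space shell crossings or half-space arm rates.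
-/

noncomputable section

namespace Summit.CriticalPhenomena.PercolationContinuityZ3.Cruxes.LogBGN.Birth

open MeasureTheory Filter
open scoped Topology
open Literature.Probability.Percolation Literature.Probability.LatticeModels
open Summit.CriticalPhenomena.PercolationContinuityZ3.Theses.PercFoamCut (LogBGN)
open Summit.CriticalPhenomena.PercolationContinuityZ3.Theorems.QuantitativeBGN.Negative
  (armH armH_antitone)

/-! ## Readback and the line's one new event -/

/-- The critical bond percolation measure on `ℤ³`. -/
abbrev μc : Measure (BondConfig (Site 3)) := bondPercolation (zdGraph 3) (criticalProbI 3)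

/-- `h(r) := P_{p_c(ℤ³)}(arm_H(0,r))`, the half-space one-arm probability of the crux. -/
def armProb (r : ℕ) : ℝ := μc.real (armH r)

/-- READBACK: the crux is literally `log r · h(r) → 0` for the event `armH r` of the 0913 Negative lane. -/
theorem logBGN_iff : LogBGN ↔ Tendsto (fun r : ℕ => Real.log (r : ℝ) * armProb r) atTop (𝓝 0) :=
  Iff.rfl

/-- The half-space SHELL-CROSSING event `ShellCross_H(r,R)`: some vertex of sup-norm `≤ r+1` is joined to
sup-distance `≥ R` by an open path all of whose vertices lie in `H ∩ {‖x‖∞ > r}` (the stubs spell this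
set out verbatim; identical to `Cruxes/HalfSpaceOneArmRate/Lines/birth.lean`'s `shellCross`). -/
def shellCross (r R : ℕ) : Set (BondConfig (Site 3)) :=
  {ω | ∃ w y : Site 3, (∀ i : Fin 3, |w i| ≤ (r : ℤ) + 1) ∧ (∃ i : Fin 3, (R : ℤ) ≤ |y i|) ∧
    ω ∈ openConnIn {x : Site 3 | 0 ≤ x 0 ∧ ∃ i : Fin 3, (r : ℤ) < |x i|} w y}

/-- Statement of `stub_shellSubmult` (named; the registered stub below spells it out verbatim). -/
abbrev ShellSubmultStmt : Prop :=
  ∀ p : unitInterval, ∀ r R : ℕ, 1 ≤ r → r < R →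
    (bondPercolation (zdGraph 3) p).real (armH R) ≤
      (bondPercolation (zdGraph 3) p).real (armH r) *
        (bondPercolation (zdGraph 3) p).real
          {ω | ∃ w y : Site 3, (∀ i : Fin 3, |w i| ≤ (r : ℤ) + 1) ∧ (∃ i : Fin 3, (R : ℤ) ≤ |y i|) ∧
            ω ∈ openConnIn {x : Site 3 | 0 ≤ x 0 ∧ ∃ i : Fin 3, (r : ℤ) < |x i|} w y}

/-- Statement of `stub_powerShell` (named; the registered stub below spells it out verbatim). -/
abbrev PowerShellStmt : Prop :=
  ∃ (m r₀ : ℕ) (q : ℝ), 2 ≤ m ∧ 2 ≤ r₀ ∧ (m : ℝ) * q < 1 ∧ ∀ r : ℕ, r₀ ≤ r →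
    (bondPercolation (zdGraph 3) (criticalProbI 3)).real
        {ω | ∃ w y : Site 3, (∀ i : Fin 3, |w i| ≤ (r : ℤ) + 1) ∧ (∃ i : Fin 3, ((r ^ m : ℕ) : ℤ) ≤ |y i|) ∧
          ω ∈ openConnIn {x : Site 3 | 0 ≤ x 0 ∧ ∃ i : Fin 3, (r : ℤ) < |x i|} w y} ≤ q

/-- `shellCross` is the event spelled out in the stubs. -/
theorem shellCross_eq (r R : ℕ) : shellCross r R =
    {ω | ∃ w y : Site 3, (∀ i : Fin 3, |w i| ≤ (r : ℤ) + 1) ∧ (∃ i : Fin 3, (R : ℤ) ≤ |y i|) ∧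
      ω ∈ openConnIn {x : Site 3 | 0 ≤ x 0 ∧ ∃ i : Fin 3, (r : ℤ) < |x i|} w y} := rfl

/-! ## Registered stubs -/

/-- **stub_shellSubmult (p-blind plumbing; provable now; size M).** Half-space arm submultiplicativity across
a shell: for every `p` and `1 ≤ r < R`, `P_p(arm_H(0,R)) ≤ P_p(arm_H(0,r)) · P_p(ShellCross_H(r,R))`
(first-entrance / last-exit decomposition of an open `H`-path at `Λ_r` + independence of events determined by
disjoint edge sets under the product measure; a.s. `ω ⊆ E(ℤ³)`). Shared verbatim with the 6983 birth line. -/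
theorem stub_shellSubmult : ∀ p : unitInterval, ∀ r R : ℕ, 1 ≤ r → r < R →
    (bondPercolation (zdGraph 3) p).real (armH R) ≤
      (bondPercolation (zdGraph 3) p).real (armH r) *
        (bondPercolation (zdGraph 3) p).real
          {ω | ∃ w y : Site 3, (∀ i : Fin 3, |w i| ≤ (r : ℤ) + 1) ∧ (∃ i : Fin 3, (R : ℤ) ≤ |y i|) ∧
            ω ∈ openConnIn {x : Site 3 | 0 ≤ x 0 ∧ ∃ i : Fin 3, (r : ℤ) < |x i|} w y} := by
  sorry

/-- **stub_powerShell (OPEN core; crux-class; load-bearing).** Superpolynomial half-space steering at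
`p_c(ℤ³)`: for some integer power `m ≥ 2`, scale `r₀ ≥ 2` and ceiling `q` with `m q < 1`,
`P_{p_c}(ShellCross_H(r, r^m)) ≤ q` for every `r ≥ r₀` (scaling: `≍ r^{-(m-1) x_s} → 0`, `x_s ≈ 0.975`;
BGN gives the bound for each fixed `r` at SOME scale `R(r)` in place of `r^m`, with no control of `R(r)`). -/
theorem stub_powerShell : ∃ (m r₀ : ℕ) (q : ℝ), 2 ≤ m ∧ 2 ≤ r₀ ∧ (m : ℝ) * q < 1 ∧ ∀ r : ℕ, r₀ ≤ r →
    (bondPercolation (zdGraph 3) (criticalProbI 3)).real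
        {ω | ∃ w y : Site 3, (∀ i : Fin 3, |w i| ≤ (r : ℤ) + 1) ∧ (∃ i : Fin 3, ((r ^ m : ℕ) : ℤ) ≤ |y i|) ∧
          ω ∈ openConnIn {x : Site 3 | 0 ≤ x 0 ∧ ∃ i : Fin 3, (r : ℤ) < |x i|} w y} ≤ q := by
  sorry

theorem shellSubmult_holds : ShellSubmultStmt := stub_shellSubmult
theorem powerShell_holds : PowerShellStmt := stub_powerShell

/-! ### Name-keyed aliases of the stub statements
`__Registered.stub_X` is the statement of `stub_X` under the registered stub's short name, so that the native
skeleton audit (`#h21_check_skeleton`: hypotheses admissible iff registered obligations / declared stubs BY NAME)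
accepts `LogBGN_of : __Registered.stub_shellSubmult → __Registered.stub_powerShell → LogBGN` (device of the
sibling birth files `Cruxes/HalfSpaceOneArmRate/Lines/birth.lean`, `Cruxes/BGNOffTheFloor/Lines/birth.lean`). -/
namespace __Registered

/-- Alias of `ShellSubmultStmt` keyed by the registered stub name. -/
abbrev stub_shellSubmult : Prop := ShellSubmultStmt
/-- Alias of `PowerShellStmt` keyed by the registered stub name. -/
abbrev stub_powerShell : Prop := PowerShellStmt

end __Registered

/-! ## The multiscale bookkeeping (proved) -/

/-- **Superpolynomial-scale bookkeeping.** If `P : ℕ → [0,1]` is non-increasing and submultiplicative across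
shells with factors `S r R ≥ 0`, and the factor across the power shell `(r, r^m)` (`m ≥ 2`) is at most `q`
from scale `r₀ ≥ 2` on, where `m q < 1`, then `log r · P r → 0`. [folklore] -/
theorem logRate_of_powerShell (P : ℕ → ℝ) (S : ℕ → ℕ → ℝ)
    (hP0 : ∀ r, 0 ≤ P r) (hP1 : ∀ r, P r ≤ 1) (hanti : Antitone P) (hS0 : ∀ r R, 0 ≤ S r R)
    (hsub : ∀ r R : ℕ, 1 ≤ r → r < R → P R ≤ P r * S r R)
    {m r₀ : ℕ} {q : ℝ} (hm : 2 ≤ m) (hr₀ : 2 ≤ r₀) (hmq : (m : ℝ) * q < 1)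
    (hS : ∀ r : ℕ, r₀ ≤ r → S r (r ^ m) ≤ q) :
    Tendsto (fun r : ℕ => Real.log (r : ℝ) * P r) atTop (𝓝 0) := by
  have hm1 : 1 < m := lt_of_lt_of_le one_lt_two hm
  have hr₀1 : 1 < r₀ := lt_of_lt_of_le one_lt_two hr₀
  have hr₀pos : 0 < r₀ := lt_trans zero_lt_one hr₀1
  have hmR : (0 : ℝ) < m := by exact_mod_cast (lt_trans zero_lt_one hm1)
  have hq0 : 0 ≤ q := (hS0 r₀ (r₀ ^ m)).trans (hS r₀ le_rfl)
  have hmq0 : (0 : ℝ) ≤ (m : ℝ) * q := mul_nonneg hmR.le hq0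
  -- Step 1: geometric decay along the scales `r₀ ^ (m ^ k)`.
  have hscale_ge : ∀ k : ℕ, r₀ ≤ r₀ ^ (m ^ k) := fun k => by
    calc r₀ = r₀ ^ 1 := (pow_one r₀).symm
      _ ≤ r₀ ^ (m ^ k) := pow_le_pow_right₀ hr₀1.le (Nat.one_le_pow _ _ (lt_trans zero_lt_one hm1))
  have hgeo : ∀ k : ℕ, P (r₀ ^ (m ^ k)) ≤ q ^ k := by
    intro k
    induction k with
    | zero => simpa using hP1 r₀
    | succ k ih =>
      set r := r₀ ^ (m ^ k) with hr
      have hrr₀ : r₀ ≤ r := hscale_ge k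
      have hr1 : 1 < r := lt_of_lt_of_le hr₀1 hrr₀
      have hrlt : r < r ^ m := by
        calc r = r ^ 1 := (pow_one r).symm
          _ < r ^ m := Nat.pow_lt_pow_right hr1 hm1
      have e : r₀ ^ (m ^ (k + 1)) = r ^ m := by
        rw [hr, ← pow_mul, ← pow_succ]
      rw [e]
      calc P (r ^ m) ≤ P r * S r (r ^ m) := hsub r (r ^ m) hr1.le hrlt
        _ ≤ q ^ k * q := mul_le_mul ih (hS r hrr₀) (hS0 _ _) (pow_nonneg hq0 k)
        _ = q ^ (k + 1) := by rw [pow_succ]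
  -- Step 2: every `r ≥ r₀` sits in a window `r₀^(m^k) ≤ r < r₀^(m^(k+1))`, and `k` dominates every `K`
  -- with `r₀^(m^K) ≤ r`.
  have hwin : ∀ r : ℕ, r₀ ≤ r → ∃ k : ℕ, r₀ ^ (m ^ k) ≤ r ∧ r < r₀ ^ (m ^ (k + 1)) ∧
      ∀ K : ℕ, r₀ ^ (m ^ K) ≤ r → K ≤ k := by
    intro r hr
    have hr0 : r ≠ 0 := by omega
    set L := Nat.log r₀ r with hL
    have hL1 : r₀ ^ L ≤ r := Nat.pow_log_le_self r₀ hr0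
    have hL2 : r < r₀ ^ (L + 1) := Nat.lt_pow_succ_log_self hr₀1 r
    have hL0 : L ≠ 0 := (Nat.log_pos hr₀1 hr).ne'
    set k := Nat.log m L with hk
    have hk1 : m ^ k ≤ L := Nat.pow_log_le_self m hL0
    have hk2 : L < m ^ (k + 1) := Nat.lt_pow_succ_log_self hm1 L
    refine ⟨k, ?_, ?_, ?_⟩
    · exact (pow_le_pow_right₀ hr₀1.le hk1).trans hL1
    · exact lt_of_lt_of_le hL2 (pow_le_pow_right₀ hr₀1.le hk2)
    · intro K hK
      have h1 : r₀ ^ (m ^ K) < r₀ ^ (L + 1) := lt_of_le_of_lt hK hL2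
      have h2 : m ^ K < L + 1 := (pow_lt_pow_iff_right₀ hr₀1).1 h1
      exact Nat.le_log_of_pow_le hm1 (by omega)
  -- Step 3: `ε`-management.
  rw [Metric.tendsto_atTop]
  intro ε hε
  set c : ℝ := (m : ℝ) * Real.log r₀ with hc
  have hlogr₀ : 0 < Real.log (r₀ : ℝ) := Real.log_pos (by exact_mod_cast hr₀1)
  have hcpos : 0 < c := mul_pos hmR hlogr₀
  obtain ⟨K, hK⟩ := exists_pow_lt_of_lt_one (div_pos hε hcpos) hmq
  refine ⟨r₀ ^ (m ^ K), fun n hn => ?_⟩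
  have hnr₀ : r₀ ≤ n := (hscale_ge K).trans hn
  have hn1 : (1 : ℝ) ≤ n := by exact_mod_cast (le_trans hr₀1.le hnr₀)
  have hnpos : (0 : ℝ) < n := lt_of_lt_of_le zero_lt_one hn1
  obtain ⟨k, hk1, hk2, hk3⟩ := hwin n hnr₀
  have hKk : K ≤ k := hk3 K hn
  have hPn : P n ≤ q ^ k := (hanti hk1).trans (hgeo k)
  have hlog0 : 0 ≤ Real.log (n : ℝ) := Real.log_nonneg hn1
  have hlog : Real.log (n : ℝ) ≤ (m : ℝ) ^ (k + 1) * Real.log r₀ := by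
    have h1 : (n : ℝ) ≤ ((r₀ ^ (m ^ (k + 1)) : ℕ) : ℝ) := by exact_mod_cast hk2.le
    have h2 : Real.log (n : ℝ) ≤ Real.log (((r₀ ^ (m ^ (k + 1)) : ℕ) : ℝ)) := Real.log_le_log hnpos h1
    have e : Real.log (((r₀ ^ (m ^ (k + 1)) : ℕ) : ℝ)) = (m : ℝ) ^ (k + 1) * Real.log r₀ := by
      push_cast
      rw [Real.log_pow]
      push_cast
      ring
    rwa [e] at h2
  have hbound : Real.log (n : ℝ) * P n ≤ c * ((m : ℝ) * q) ^ k := by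
    calc Real.log (n : ℝ) * P n ≤ ((m : ℝ) ^ (k + 1) * Real.log r₀) * q ^ k :=
          mul_le_mul hlog hPn (hP0 n) (le_trans hlog0 hlog)
      _ = c * ((m : ℝ) * q) ^ k := by rw [hc, mul_pow]; ring
  have hmono : ((m : ℝ) * q) ^ k ≤ ((m : ℝ) * q) ^ K := pow_le_pow_of_le_one hmq0 hmq.le hKk
  have hfin : Real.log (n : ℝ) * P n < ε := by
    calc Real.log (n : ℝ) * P n ≤ c * ((m : ℝ) * q) ^ k := hbound
      _ ≤ c * ((m : ℝ) * q) ^ K := mul_le_mul_of_nonneg_left hmono hcpos.le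
      _ < c * (ε / c) := mul_lt_mul_of_pos_left hK hcpos
      _ = ε := mul_div_cancel₀ ε hcpos.ne'
  rw [Real.dist_eq, sub_zero, abs_of_nonneg (mul_nonneg hlog0 (hP0 n))]
  exact hfin

/-! ## Composition: the two stubs prove the crux BY NAME -/

/-- **Composition (kernel-checked, no `sorry`).** `stub_shellSubmult → stub_powerShell → LogBGN`: unpack
`m, r₀, q` from the power-shell stub and run `logRate_of_powerShell` with `P r = P_{p_c}(arm_H(0,r))`,
`S r R = P_{p_c}(ShellCross_H(r,R))`, the submultiplicativity stub at `p = p_c`, `armH_antitone` and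
`0 ≤ P ≤ 1`. -/
theorem LogBGN_of (h₁ : __Registered.stub_shellSubmult) (h₂ : __Registered.stub_powerShell) :
    Summit.CriticalPhenomena.PercolationContinuityZ3.Theses.PercFoamCut.LogBGN := by
  obtain ⟨m, r₀, q, hm, hr₀, hmq, hS⟩ := h₂
  rw [logBGN_iff]
  refine logRate_of_powerShell (fun r => μc.real (armH r))
    (fun r R => μc.real
      {ω | ∃ w y : Site 3, (∀ i : Fin 3, |w i| ≤ (r : ℤ) + 1) ∧ (∃ i : Fin 3, (R : ℤ) ≤ |y i|) ∧
        ω ∈ openConnIn {x : Site 3 | 0 ≤ x 0 ∧ ∃ i : Fin 3, (r : ℤ) < |x i|} w y})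
    (fun r => measureReal_nonneg) (fun r => measureReal_le_one)
    (fun r s hrs => measureReal_mono (armH_antitone hrs)) (fun r R => measureReal_nonneg)
    (fun r R hr hrR => h₁ (criticalProbI 3) r R hr hrR) hm hr₀ hmq ?_
  intro r hr
  exact hS r hr

/-- Wiring check: plugging the (sorried) registered stubs into the composition yields the crux — the
spelled-out stub signatures are definitionally the `__Registered.*` aliases. -/
example : Summit.CriticalPhenomena.PercolationContinuityZ3.Theses.PercFoamCut.LogBGN :=
  LogBGN_of stub_shellSubmult stub_powerShell


end Summit.CriticalPhenomena.PercolationContinuityZ3.Cruxes.LogBGN.Birth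

end
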